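import Summits.QuantumFields.YangMills.Theorems.BalabanUVNodesN22W1PrintedBoxWindowCap

/-!
# BalabanUVNodes ∕ node N22 = NE9 — LOCATED (A6-class, count-neutral), SMALL-FIELD SIDE: AT PRINT'S BOXES EVERY INHABITANT OF THE s1 RECORD AT A SMALL-FIELD SLICE WITH A
# SMALL-FIELD ROW BOND HAS `Rb² ≤ (ε₁∕s₀)²`, `κ·cE ≤ ½`, hence `e^{−(ε₁∕s₀)²∕(4cE)} ≤ T·s₀²` and `Mv ≥ 1 + e^{−(ε₁∕s₀)²∕(4cE)}∕s₀²`; with the knit's aperture numeral at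
# `s₀ = γ` this caps the window: `γ² + e^{−ε₁²∕(4cEγ²)} ≤ ½` (so `γ² < ½` AND `4·cE·γ²·log 2 < ε₁²`)

Cell `pub-ymgap`, HUMAN RULING D-0062 (Track A) ∕ D-0149 (width seats), seat `pub-ymgap-dag-n22-w1` (WIDTH SEAT 1 of 3 on node n22; «A6-residue flag №3 lane»), generation 0, file 7.
THEOREMS ONLY (0 `def`, 0 `sorry`); imports this seat's `…PrintedBoxWindowCap` (p586843: `cE_pos`, the test-field lemmas; through it file 1 and dag-n22-c's J17-D); restates nothing.
`--kind proof --supports stmt-QuantumFields-20544 --as helper` (K3⁷ `SpineGivenEndpointR13SepCoPH`).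

WHY.  p586843 read the LARGE-FIELD fields (`h222 ∧ hPa ∧ hαc_0`) of J17-D's record at print's boxes and found `2·a·cE·s₀² ≤ ε₁²`.  THIS FILE reads the SMALL-FIELD fields: the box law
`hboxR : P(t) = ∅ → ⟨B,B⟩ < Rb² → χᵘχᶜᵘ(s₀·B) = 1`, the tail rate `hRb : e^{−½κRb²} ≤ T·s₀²`, `hMvT : 1 + T ≤ Mv` and the numeral `hαc_b : (2θ(…) + (κ + a₀))·cE ≤ ½`.  With print's
small-field box on a row-bond set `Y₀ ∋ b₀`, the box law tested at `B₁ := (ε₁∕s₀)·𝟙_{b₀}` (where `|s₀·B₁(b₀)| = ε₁` is NOT `< ε₁`, so `χᵘ(s₀·B₁) = 0`) FORCES `Rb² ≤ (ε₁∕s₀)²`; the numeral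
gives `κ·cE ≤ ½`; hence `e^{−(ε₁∕s₀)²∕(4cE)} ≤ e^{−½κRb²} ≤ T·s₀²` and `Mv ≥ 1 + e^{−(ε₁∕s₀)²∕(4cE)}∕s₀²` — the small-field twin of the window cap.  §3 joins it with dag-n22-c's knit
J17-K aperture numeral `hMvγ : (1−cP)⁻²·Mv·((1+cA)γ)² ≤ ½` (`0 ≤ cA`, `0 ≤ cP < 1`) read at a small-field slice AT THE TOP OF THE WINDOW `s₀ = γ`: `γ² + e^{−ε₁²∕(4cEγ²)} ≤ ½`,
so dag-n22-w2's `γ² < ½` AND a box-side cap `4·cE·γ²·log 2 < ε₁²`.  READING: print's regime again (`g_k ≪ ε₁`: the small-field box tail is invisible only when `ε₁∕g_k` is large);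
A6: the hypotheses are met by this seat's small-field print-box witness (`…PrintedBoxWitnessSmallField`, `cE = 1`, `Y₀ = univ`).

HONEST FRAMING — what this is NOT.  Arithmetic on the record's own fields at one explicit test field; count-neutral; NOT a discharge of N22, NOT a refutation (the record stays inhabited on base
points obeying the relations); whether the datum of record's window obeys the cap is the record's numeral to display (def-T ∕ plan); `cE` is NODE A's letter.  One finite four-torus
programme at fixed ε — R4 closes the conditional rung `BalabanLadder.UV` only; NOT continuum, NOT OS, NOT a mass gap, NOT Clay.  0 `sorry`, standard axioms.

References (TYPES ∕ loci only): [I] = [Balaban1987RG1] (2.9) p. 266, (2.13) p. 268, §1 p. 263; [II] = [Balaban1988RG2Cluster] (2.3) p. 12, (2.22) p. 16.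
-/

namespace Summit.QuantumFields.YangMills.BalabanUVNodes.N22PrintedBoxBlock

open Set Metric Matrix
open scoped BigOperators
open Literature.MathematicalPhysics.QuantumFieldTheory.Balaban1983to89
open Literature.MathematicalPhysics.QuantumFieldTheory.Balaban1983to89.TreeLengthTorus (TDom)
open Literature.MathematicalPhysics.QuantumFieldTheory.Balaban1983to89.Step (SFConsts)
open Literature.MathematicalPhysics.QuantumFieldTheory.Balaban1983to89.Node00
open Literature.MathematicalPhysics.QuantumFieldTheory.Balaban1983to89.Node00.Sect2 (domSys domCount CPair Setting Residual)
open Literature.MathematicalPhysics.QuantumFieldTheory.Balaban1983to89.Node00.W1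
open YMDAG.N22.W1 (SliceInputsL2U)

/-! ## §1 The one-bond test field -/

section TestField

variable {Λ : Type*} [Fintype Λ] [DecidableEq Λ]

/-- `⟨B₁, B₁⟩ = x²` for the one-bond test field `B₁ b := if b = b₀ then x else 0`. [folklore] -/
theorem oneBondField_dotProduct (b₀ : Λ) (x : ℝ) :
    (fun b => if b = b₀ then x else 0) ⬝ᵥ (fun b => if b = b₀ then x else 0) = x ^ 2 := by
  simp only [dotProduct]
  rw [Finset.sum_eq_single b₀]
  · simp [sq]
  · intro b _ hb; simp [hb]
  · intro h; exact absurd (Finset.mem_univ b₀) h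

omit [Fintype Λ] in
/-- At the one-bond test field of height `ε∕s₀` on a bond `b₀ ∈ Y₀` the small-field box VANISHES at the base point `s₀ > 0` (`|s₀·(ε∕s₀)| = ε` is not `< ε`; `ε ≥ 0`).
[cite: Balaban1987RG1, (2.9) p.266] -/
theorem chi_smul_oneBondField_eq_zero (χu : (Λ → ℝ) → ℝ) (Y₀ : Finset Λ) {ε s₀ : ℝ} (hε : 0 ≤ ε) (hs : 0 < s₀)
    (hχu : ∀ A, χu A = ∏ b ∈ Y₀, (if |A b| < ε then (1 : ℝ) else 0)) {b₀ : Λ} (hb₀ : b₀ ∈ Y₀) :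
    χu (s₀ • fun b => if b = b₀ then ε / s₀ else 0) = 0 := by
  rw [hχu]
  refine Finset.prod_eq_zero hb₀ (if_neg ?_)
  simp only [Pi.smul_apply, smul_eq_mul, if_true, mul_div_cancel₀ ε hs.ne', abs_of_nonneg hε]
  exact lt_irrefl ε

end TestField

/-! ## §2 What every print-box inhabitant satisfies at a small-field slice with a small-field row bond -/

section Inhabitant

variable {c₀ : B13.Consts} {P : Params} {𝔸 : Type*} [NormedRing 𝔸] [NormedAlgebra ℂ 𝔸] [CompleteSpace 𝔸] {M k L : ℕ} [NeZero L]
  {𝔇 : TermDatum214 c₀ P 𝔸 M k L}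
  {χu χcu : (Z : (domSys P M (k + 1)).Dom) → (t : TermLabel P M k L) → ((𝔇.𝒦 Z t).Λ → ℝ) → ℝ}
  {𝒲 : (Z : (domSys P M (k + 1)).Dom) → (t : TermLabel P M k L) → CPair P 𝔸 → TDom P.d (L * domCount P M (k + 1)) → ((𝔇.𝒦 Z t).Λ → ℝ) → ℂ}
  {𝒪 : (Z : (domSys P M (k + 1)).Dom) → (t : TermLabel P M k L) → OlderTerms P 𝔸 M k → CPair P 𝔸 → TDom P.d (L * domCount P M (k + 1)) →
    ((𝔇.𝒦 Z t).Λ → ℝ) → ℂ}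
  {c : B13.Consts} {G : Type*} [GaugeGroup G] {Sg : Setting 𝔸 G} {Rz : Residual P 𝔸} {cs : SFConsts} {E₀ κE : ℝ}
  {Z : (domSys P M (k + 1)).Dom} {t : TermLabel P M k L} {W : Set (CPair P 𝔸)} {s₀ a a₅ ρb Mv : ℝ}
  {Y₀ : Finset (𝔇.𝒦 Z t).Λ} {ε : ℝ}

/-- **`κ·cE ≤ ½` FOR EVERY INHABITANT** (from `hαc_b : (2θ(…) + (κ + a₀))·cE ≤ ½`, `θ ≥ θE ≥ 0`, `a₀ ≥ 0`, `cE ≥ 0`). [cite: Balaban1988RG2Cluster, (2.22) p.16] -/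
theorem kappa_mul_cE_le_half (V : SliceInputsL2U 𝔇 χu χcu 𝒲 𝒪 c Sg Rz cs E₀ κE Z t W s₀ a a₅ ρb Mv) : V.κ * V.cE ≤ 1 / 2 := by
  have hθ : 0 ≤ V.θ := V.hθE.trans V.hθEle0
  have hm : 0 ≤ V.θ * (((𝔇.𝒦 Z t).m : ℝ) * (1 + 2 / V.kap'') ^ 𝔇.ν) :=
    mul_nonneg hθ (mul_nonneg (Nat.cast_nonneg _) (pow_nonneg (by have := V.hkap''; positivity) _))
  have h := V.hαc_b
  nlinarith [V.hc0, V.ha₀, V.hκ, hm, mul_nonneg hm V.hc0, mul_nonneg V.ha₀ V.hc0]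

/-- **PRINT'S SMALL-FIELD BOX FORCES THE BOX RADIUS**: at a small-field slice (`P(t) = ∅`) with print's box on `Y₀ ∋ b₀`, `Rb² ≤ (ε∕s₀)²` — else the box law `hboxR` at the one-bond
test field of height `ε∕s₀` would give `χᵘ·χᶜᵘ = 1` where `χᵘ = 0`. [cite: Balaban1987RG1, (2.9) p.266] -/
theorem Rb_sq_le_of_printedBoxes (V : SliceInputsL2U 𝔇 χu χcu 𝒲 𝒪 c Sg Rz cs E₀ κE Z t W s₀ a a₅ ρb Mv)
    (hχu : ∀ A, χu Z t A = ∏ b ∈ Y₀, (if |A b| < ε then (1 : ℝ) else 0)) {b₀ : (𝔇.𝒦 Z t).Λ} (hb₀ : b₀ ∈ Y₀)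
    (hP : t.2 = ∅) (hε : 0 ≤ ε) (hs : 0 < s₀) : V.Rb ^ 2 ≤ (ε / s₀) ^ 2 := by
  classical
  by_contra hlt
  have hB : (fun b => if b = b₀ then ε / s₀ else 0) ⬝ᵥ (fun b => if b = b₀ then ε / s₀ else 0) < V.Rb ^ 2 := by
    rw [oneBondField_dotProduct]; exact not_le.1 hlt
  have h1 := V.hboxR hP _ hB
  rw [chi_smul_oneBondField_eq_zero (χu Z t) Y₀ hε hs hχu hb₀, zero_mul] at h1
  exact zero_ne_one h1

/-- **… hence the tail letter is bounded below**: `e^{−(ε∕s₀)²∕(4·cE)} ≤ T·s₀²` (`hRb` with `½κRb² ≤ ½κ(ε∕s₀)² ≤ (ε∕s₀)²∕(4cE)`). [cite: Balaban1987RG1, (2.13) p.268; Balaban1988RG2Cluster, (2.22) p.16] -/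
theorem exp_le_T_mul_sq_of_printedBoxes (V : SliceInputsL2U 𝔇 χu χcu 𝒲 𝒪 c Sg Rz cs E₀ κE Z t W s₀ a a₅ ρb Mv)
    (hχu : ∀ A, χu Z t A = ∏ b ∈ Y₀, (if |A b| < ε then (1 : ℝ) else 0)) {b₀ : (𝔇.𝒦 Z t).Λ} (hb₀ : b₀ ∈ Y₀)
    (hP : t.2 = ∅) (hε : 0 ≤ ε) (hs : 0 < s₀) :
    Real.exp (-((ε / s₀) ^ 2 / (4 * V.cE))) ≤ V.T * s₀ ^ 2 := by
  have hcE := cE_pos V b₀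
  have hRb := Rb_sq_le_of_printedBoxes V hχu hb₀ hP hε hs
  have hκ := kappa_mul_cE_le_half V
  refine le_trans (Real.exp_le_exp.2 ?_) (V.hRb hP)
  -- `−(ε/s₀)²/(4cE) ≤ −(κ/2)·Rb²`
  have h1 : V.κ / 2 * V.Rb ^ 2 ≤ V.κ / 2 * (ε / s₀) ^ 2 := mul_le_mul_of_nonneg_left hRb (by linarith [V.hκ])
  have h2 : V.κ / 2 * (ε / s₀) ^ 2 ≤ (ε / s₀) ^ 2 / (4 * V.cE) := by
    rw [le_div_iff₀ (by positivity)]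
    nlinarith [sq_nonneg (ε / s₀)]
  linarith

/-- ★ **THE SMALL-FIELD WINDOW NUMERAL**: every print-box inhabitant at a small-field slice with a small-field row bond has `1 + e^{−(ε∕s₀)²∕(4cE)}∕s₀² ≤ Mv`.
[cite: Balaban1987RG1, (2.9) p.266 and (2.13) p.268] -/
theorem Mv_lower_bound_of_printedBoxes (V : SliceInputsL2U 𝔇 χu χcu 𝒲 𝒪 c Sg Rz cs E₀ κE Z t W s₀ a a₅ ρb Mv)
    (hχu : ∀ A, χu Z t A = ∏ b ∈ Y₀, (if |A b| < ε then (1 : ℝ) else 0)) {b₀ : (𝔇.𝒦 Z t).Λ} (hb₀ : b₀ ∈ Y₀)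
    (hP : t.2 = ∅) (hε : 0 ≤ ε) (hs : 0 < s₀) :
    1 + Real.exp (-((ε / s₀) ^ 2 / (4 * V.cE))) / s₀ ^ 2 ≤ Mv := by
  have h := exp_le_T_mul_sq_of_printedBoxes V hχu hb₀ hP hε hs
  have hT : Real.exp (-((ε / s₀) ^ 2 / (4 * V.cE))) / s₀ ^ 2 ≤ V.T := by
    rw [div_le_iff₀ (by positivity)]; exact h
  linarith [V.hMvT hP]

end Inhabitant

/-! ## §3 Joined with the knit's aperture numeral at the top of the window -/

/-- ★ **THE WINDOW CAP, SMALL-FIELD SIDE**: if a vertex constant `Mv ≥ 1 + e^{−ε²∕(4cEγ²)}∕γ²` (what §2 forces at the base point `s₀ = γ`) ALSO meets the knit's aperture numeral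
`(1−cP)⁻²·Mv·((1+cA)γ)² ≤ ½` with `0 ≤ cA`, `0 ≤ cP < 1`, then `γ² + e^{−ε²∕(4cEγ²)} ≤ ½`. [cite: Balaban1987RG1, §1 p.263 («γ sufficiently small»)] -/
theorem window_cap_smallField {Mv γ ε cE cA cP : ℝ} (hγ : 0 < γ)
    (hMv : 1 + Real.exp (-((ε / γ) ^ 2 / (4 * cE))) / γ ^ 2 ≤ Mv)
    (hcA : 0 ≤ cA) (hcP0 : 0 ≤ cP) (hcP1 : cP < 1) (hMvγ : (1 - cP)⁻¹ ^ 2 * Mv * ((1 + cA) * γ) ^ 2 ≤ 1 / 2) :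
    γ ^ 2 + Real.exp (-(ε ^ 2 / (4 * cE * γ ^ 2))) ≤ 1 / 2 := by
  have hγ2 : 0 < γ ^ 2 := by positivity
  have hexp : Real.exp (-((ε / γ) ^ 2 / (4 * cE))) = Real.exp (-(ε ^ 2 / (4 * cE * γ ^ 2))) := by
    congr 1; rw [div_pow]; ring
  -- `Mv·γ² ≤ (1−cP)⁻²·Mv·((1+cA)γ)²` since `(1−cP)⁻² ≥ 1`, `(1+cA)² ≥ 1`, `Mv ≥ 0`
  have hMv0 : 0 ≤ Mv := by
    have : 0 ≤ Real.exp (-((ε / γ) ^ 2 / (4 * cE))) / γ ^ 2 := by positivity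
    linarith
  have hinv : 1 ≤ (1 - cP)⁻¹ ^ 2 := by
    have h1 : 1 ≤ (1 - cP)⁻¹ := by rw [le_inv_comm₀ one_pos (by linarith), inv_one]; linarith
    nlinarith
  have hA : γ ^ 2 ≤ ((1 + cA) * γ) ^ 2 := by rw [mul_pow]; nlinarith [sq_nonneg cA]
  have hle : Mv * γ ^ 2 ≤ (1 - cP)⁻¹ ^ 2 * Mv * ((1 + cA) * γ) ^ 2 := by
    calc Mv * γ ^ 2 = 1 * Mv * γ ^ 2 := by ring
      _ ≤ (1 - cP)⁻¹ ^ 2 * Mv * ((1 + cA) * γ) ^ 2 := by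
        apply mul_le_mul (mul_le_mul_of_nonneg_right hinv hMv0) hA hγ2.le
        exact mul_nonneg (by positivity) hMv0
  have hkey : (1 + Real.exp (-((ε / γ) ^ 2 / (4 * cE))) / γ ^ 2) * γ ^ 2 ≤ 1 / 2 :=
    (mul_le_mul_of_nonneg_right hMv hγ2.le).trans (hle.trans hMvγ)
  have hexpand : (1 + Real.exp (-((ε / γ) ^ 2 / (4 * cE))) / γ ^ 2) * γ ^ 2 = γ ^ 2 + Real.exp (-((ε / γ) ^ 2 / (4 * cE))) := by
    field_simp
  rw [hexpand, hexp] at hkey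
  exact hkey

/-- … in particular `γ² < ½` (dag-n22-w2's aperture side) AND `4·cE·γ²·log 2 < ε²` (the box side; `cE > 0`). [cite: Balaban1987RG1, §1 p.263] -/
theorem window_caps_of_smallField {γ ε cE : ℝ} (hγ : 0 < γ) (hcE : 0 < cE) (h : γ ^ 2 + Real.exp (-(ε ^ 2 / (4 * cE * γ ^ 2))) ≤ 1 / 2) :
    γ ^ 2 < 1 / 2 ∧ 4 * cE * γ ^ 2 * Real.log 2 < ε ^ 2 := by
  have hγ2 : 0 < γ ^ 2 := by positivity
  have he : 0 < Real.exp (-(ε ^ 2 / (4 * cE * γ ^ 2))) := Real.exp_pos _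
  refine ⟨by linarith, ?_⟩
  -- `exp(−x) < ½` with `x = ε²/(4cEγ²)` gives `log 2 < x`
  have hlt : Real.exp (-(ε ^ 2 / (4 * cE * γ ^ 2))) < 1 / 2 := by linarith
  have hx : Real.log 2 < ε ^ 2 / (4 * cE * γ ^ 2) := by
    have h2 : Real.exp (-(ε ^ 2 / (4 * cE * γ ^ 2))) < Real.exp (-Real.log 2) := by
      rw [Real.exp_neg (Real.log 2), Real.exp_log two_pos]; norm_num at hlt ⊢; exact hlt
    have := Real.exp_lt_exp.1 h2
    linarith
  have hden : 0 < 4 * cE * γ ^ 2 := by positivity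
  have := (lt_div_iff₀ hden).1 hx
  linarith [this]

end Summit.QuantumFields.YangMills.BalabanUVNodes.N22PrintedBoxBlock
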